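import Summits.KontsevichZagierPeriods.KontsevichZagierPeriods.Theorems.LinRedNormalFormArrangementNormalFormStubRebaseSimpleZeroNestedSection

/-!
# Stub `stub_rebaseSimpleZero`, part `rebaseSimpleZero_nested2` (crux `ArrangementNormalForm`,
line `janus-bands`, v6.2) — brick `NestedBlowMap`

Calculus of the PINCH-VERTEX BLOW-UP of a nested pair over a one-dimensional base (drefute g3,
§5), in the chart `Ψ(b, a, Z) = (y₀ + ε Z/b, t₀ + ε a Z/b, t₀ + ε Z)` (new base `b` = slope of
the radial fibre, new fibre `a` = slope of the polar fibre, new fibre `Z` = rescaled radial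
fibre): `Ψ` is a rational, hence `ℚ`-semialgebraic, map off `b = 0`, differentiable with the
explicit Jacobian matrix `RebaseNest.blow_hasFDerivAt` of determinant `−ε³ Z²/b³`
(`RebaseNest.blow_det`), and injective off `b Z = 0` (`RebaseNest.blow_injOn`). Registered
support goal: `rebaseSimpleZero_nestedBlowDet`.

References: M. Kontsevich, D. Zagier, *Periods* (2001), §1.2, rule (2).
-/

noncomputable section

open Set MeasureTheory MvPolynomial
open Literature.NumberTheory.Transcendental Literature.ModelTheory.ExponentialFields

namespace Summit.KontsevichZagierPeriods.ArrangementNormalForm.JanusBands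

namespace RebaseNest

section BlowMap

variable (ε y₀ t₀ : ℝ)

/-- The Jacobian matrix of the blow-up chart, applied to a vector. -/
theorem blow_jac_apply (w v : Fin 3 → ℝ) :
    Matrix.toLin' !![-(ε * w 2) / w 0 ^ 2, 0, ε / w 0; -(ε * w 1 * w 2) / w 0 ^ 2, ε * w 2 / w 0, ε * w 1 / w 0;
      0, 0, ε] v = ![-(ε * w 2) / w 0 ^ 2 * v 0 + ε / w 0 * v 2,
      -(ε * w 1 * w 2) / w 0 ^ 2 * v 0 + ε * w 2 / w 0 * v 1 + ε * w 1 / w 0 * v 2, ε * v 2] := by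
  ext k
  fin_cases k <;> simp [Matrix.toLin'_apply, Matrix.mulVec, dotProduct, Fin.sum_univ_three]

/-- The Jacobian determinant of the blow-up chart: `−ε³ Z²/b³`. -/
theorem blow_det (w : Fin 3 → ℝ) (hw : w 0 ≠ 0) :
    (LinearMap.toContinuousLinearMap (Matrix.toLin' !![-(ε * w 2) / w 0 ^ 2, 0, ε / w 0;
      -(ε * w 1 * w 2) / w 0 ^ 2, ε * w 2 / w 0, ε * w 1 / w 0; 0, 0, ε])).det =
      -(ε ^ 3 * w 2 ^ 2 / w 0 ^ 3) := by
  rw [ContinuousLinearMap.det, LinearMap.coe_toContinuousLinearMap, LinearMap.det_toLin',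
    Matrix.det_fin_three]
  simp only [Matrix.of_apply, Matrix.cons_val', Matrix.cons_val_zero, Matrix.cons_val_one,
    Matrix.cons_val_two, Matrix.empty_val', Matrix.cons_val_fin_one, Matrix.head_cons, Matrix.tail_cons,
    Matrix.head_fin_const]
  field_simp
  ring

/-- The blow-up chart is differentiable off `b = 0`, with the explicit Jacobian. -/
theorem blow_hasFDerivAt (w : Fin 3 → ℝ) (hw : w 0 ≠ 0) :
    HasFDerivAt (fun w : Fin 3 → ℝ => (![y₀ + ε * w 2 / w 0, t₀ + ε * w 1 * w 2 / w 0, t₀ + ε * w 2] :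
        Fin 3 → ℝ))
      (LinearMap.toContinuousLinearMap (Matrix.toLin' !![-(ε * w 2) / w 0 ^ 2, 0, ε / w 0;
        -(ε * w 1 * w 2) / w 0 ^ 2, ε * w 2 / w 0, ε * w 1 / w 0; 0, 0, ε])) w := by
  have h0 : HasFDerivAt (fun x : Fin 3 → ℝ => x 0)
      (ContinuousLinearMap.proj (R := ℝ) (φ := fun _ : Fin 3 => ℝ) 0) w := hasFDerivAt_apply 0 w
  have h1 : HasFDerivAt (fun x : Fin 3 → ℝ => x 1)
      (ContinuousLinearMap.proj (R := ℝ) (φ := fun _ : Fin 3 => ℝ) 1) w := hasFDerivAt_apply 1 w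
  have h2 : HasFDerivAt (fun x : Fin 3 → ℝ => x 2)
      (ContinuousLinearMap.proj (R := ℝ) (φ := fun _ : Fin 3 => ℝ) 2) w := hasFDerivAt_apply 2 w
  have hinv : HasFDerivAt (fun x : Fin 3 → ℝ => (x 0)⁻¹)
      ((ContinuousLinearMap.toSpanSingleton ℝ (-(w 0 ^ 2)⁻¹)).comp
        (ContinuousLinearMap.proj (R := ℝ) (φ := fun _ : Fin 3 => ℝ) 0)) w :=
    (hasFDerivAt_inv hw).comp w h0
  rw [hasFDerivAt_pi']
  refine Fin.forall_fin_succ.2 ⟨?_, Fin.forall_fin_two.2 ⟨?_, ?_⟩⟩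
  · show HasFDerivAt (fun x : Fin 3 → ℝ => y₀ + ε * x 2 / x 0) _ w
    have := ((h2.const_mul ε).mul hinv).const_add y₀
    refine (this.congr_of_eventuallyEq (Filter.Eventually.of_forall fun x => by
      simp [div_eq_mul_inv])).congr_fderiv (ContinuousLinearMap.ext fun v => ?_)
    rw [ContinuousLinearMap.comp_apply, LinearMap.coe_toContinuousLinearMap', blow_jac_apply]
    simp
    field_simp
  · show HasFDerivAt (fun x : Fin 3 → ℝ => t₀ + ε * x 1 * x 2 / x 0) _ w
    have := ((((h1.const_mul ε).mul h2).mul hinv).const_add t₀)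
    refine (this.congr_of_eventuallyEq (Filter.Eventually.of_forall fun x => by
      simp [div_eq_mul_inv])).congr_fderiv (ContinuousLinearMap.ext fun v => ?_)
    rw [ContinuousLinearMap.comp_apply, LinearMap.coe_toContinuousLinearMap']
    erw [blow_jac_apply]
    simp
    field_simp
    ring
  · show HasFDerivAt (fun x : Fin 3 → ℝ => t₀ + ε * x 2) _ w
    refine ((h2.const_mul ε).const_add t₀).congr_fderiv (ContinuousLinearMap.ext fun v => ?_)
    rw [ContinuousLinearMap.comp_apply, LinearMap.coe_toContinuousLinearMap']
    erw [blow_jac_apply]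
    simp

/-- The blow-up chart is injective off `b Z = 0` (for `ε ≠ 0`). -/
theorem blow_injOn (hε : ε ≠ 0) {Q : Set (Fin 3 → ℝ)} (hQ : ∀ w ∈ Q, w 0 ≠ 0 ∧ w 2 ≠ 0) :
    InjOn (fun w : Fin 3 → ℝ => (![y₀ + ε * w 2 / w 0, t₀ + ε * w 1 * w 2 / w 0, t₀ + ε * w 2] :
      Fin 3 → ℝ)) Q := by
  intro w hw w' hw' h
  obtain ⟨hb, hZ⟩ := hQ w hw
  obtain ⟨hb', -⟩ := hQ w' hw'
  have e0 := congr_fun h 0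
  have e1 := congr_fun h 1
  have e2 := congr_fun h 2
  simp only [Matrix.cons_val_zero, Matrix.cons_val_one, Matrix.cons_val_two, Matrix.head_cons,
    Matrix.tail_cons, add_right_inj] at e0 e1 e2
  have h2 : w 2 = w' 2 := mul_left_cancel₀ hε e2
  have hεZ : ε * w 2 ≠ 0 := mul_ne_zero hε hZ
  have h0 : w 0 = w' 0 := by
    rw [← h2, div_eq_div_iff hb hb'] at e0
    exact (mul_left_cancel₀ hεZ e0).symm
  have h1 : w 1 = w' 1 := by
    rw [← h2, ← h0, div_left_inj' hb] at e1
    have : ε * w 2 * (w 1 - w' 1) = 0 := by linear_combination e1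
    simpa [hεZ, sub_eq_zero] using this
  ext k
  fin_cases k
  exacts [h0, h1, h2]

/-- The blow-up chart with rational data is a `ℚ`-semialgebraic map on any semialgebraic set
missing `b = 0` (its components are quotients of polynomials). -/
theorem blow_isSemialgebraicMapOn (ε y₀ t₀ : ℚ) {Q : Set (Fin 3 → ℝ)} (hQ : IsSemialgebraic ℚ Q)
    (hQ0 : ∀ w ∈ Q, w 0 ≠ 0) :
    IsSemialgebraicMapOn ℚ Q (fun w : Fin 3 → ℝ => (![y₀ + ε * w 2 / w 0, t₀ + ε * w 1 * w 2 / w 0,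
      t₀ + ε * w 2] : Fin 3 → ℝ)) := by
  have hX : ∀ w ∈ Q, aeval w (X 0 : MvPolynomial (Fin 3) ℚ) ≠ 0 := fun w hw => by
    simpa using hQ0 w hw
  refine IsSemialgebraicMapOn.of_forall hQ (Fin.forall_fin_succ.2 ⟨?_, Fin.forall_fin_two.2 ⟨?_, ?_⟩⟩)
  · refine (isSemialgebraicFunOn_aeval_div_aeval hQ (C y₀ * X 0 + C ε * X 2) (X 0) hX).congr
      fun w hw => ?_
    have h0 := hQ0 w hw
    simp only [map_add, map_mul, aeval_C, aeval_X, eq_ratCast, Matrix.cons_val_zero]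
    field_simp
  · refine (isSemialgebraicFunOn_aeval_div_aeval hQ (C t₀ * X 0 + C ε * X 1 * X 2) (X 0) hX).congr
      fun w hw => ?_
    have h0 := hQ0 w hw
    simp only [map_add, map_mul, aeval_C, aeval_X, eq_ratCast, Matrix.cons_val_succ, Matrix.cons_val_zero]
    field_simp
  · refine (isSemialgebraicFunOn_aeval hQ (C t₀ + C ε * X 2)).congr fun w _ => ?_
    simp

end BlowMap

end RebaseNest

/-- **Registered part of `stub_rebaseSimpleZero` / `rebaseSimpleZero_nested2` (line `janus-bands`,
v6.2): calculus of the pinch-vertex blow-up chart** `Ψ(b, a, Z) = (y₀ + ε Z/b, t₀ + ε a Z/b, t₀ + ε Z)`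
off `b = 0`: the explicit Jacobian matrix is the derivative, and its determinant is `−ε³ Z²/b³`
(`RebaseNest.blow_hasFDerivAt`, `RebaseNest.blow_det`). [Kontsevich–Zagier 2001, §1.2, rule (2)] -/
theorem rebaseSimpleZero_nestedBlowDet (ε y₀ t₀ : ℝ) (w : Fin 3 → ℝ) (hw : w 0 ≠ 0) : HasFDerivAt (fun w : Fin 3 → ℝ => (![y₀ + ε * w 2 / w 0, t₀ + ε * w 1 * w 2 / w 0, t₀ + ε * w 2] : Fin 3 → ℝ)) (LinearMap.toContinuousLinearMap (Matrix.toLin' !![-(ε * w 2) / w 0 ^ 2, 0, ε / w 0; -(ε * w 1 * w 2) / w 0 ^ 2, ε * w 2 / w 0, ε * w 1 / w 0; 0, 0, ε])) w ∧ (LinearMap.toContinuousLinearMap (Matrix.toLin' !![-(ε * w 2) / w 0 ^ 2, 0, ε / w 0; -(ε * w 1 * w 2) / w 0 ^ 2, ε * w 2 / w 0, ε * w 1 / w 0; 0, 0, ε])).det = -(ε ^ 3 * w 2 ^ 2 / w 0 ^ 3) :=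
  ⟨RebaseNest.blow_hasFDerivAt ε y₀ t₀ w hw, RebaseNest.blow_det ε w hw⟩

end Summit.KontsevichZagierPeriods.ArrangementNormalForm.JanusBands
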